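import Summits.CriticalPhenomena.CardyFormulaZ2.Theses.CardyFlipRusso

/-!
# Lead's TYPING DRAFT for the informal crux `QuadrupoleSelectionRule` (stmt-CriticalPhenomena-7029)

Not a route item and not a proof of anything the ledger tracks: a CHECKED Lean rendering of the
typing recommendation in `Lines/Sketch.md` ("type the kernel crux by its consumed conclusion,
clause (iii), at LEG level, in the vocabulary of the route items"), so that a planner can copy the
signature.  `jitLegProb R σ δ` is, verbatim, the annealed crossing probability of the route item
`JitteredTriangularLeg` (`Theses/CardyFlipRusso.lean`); `QuadrupoleSelectionRuleLegDraft` says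
that along the jitter leg the crossing probabilities are asymptotically constant, uniformly on
compact `σ`-ranges; `jitteredTriangularLeg_of_legDraft` checks that this draft, together with the
`σ = 0` anchor in the continuum discretisation (Smirnov + the hexagon/continuum dictionary, a
support item), yields the route item `JitteredTriangularLeg` — i.e. the proposed typing is
consumed exactly where the informal kernel is consumed.
-/

noncomputable section

open MeasureTheory ProbabilityTheory Filter Topology Set

namespace Summit.CriticalPhenomena.CardyFormulaZ2.Cruxes.QuadrupoleSelectionRule.TypingDraft

open Literature.Probability.LatticeModels Literature.Probability.Percolation
  Literature.Probability.RandomPlanarGeometry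

/-- The annealed crossing probability of the conformal rectangle `R` at mesh `δ` for the Voronoi
percolation of the Gaussian-jittered triangular lattice `𝕋 + σ ξ` with fair i.i.d. colours — the
expression of the route item `JitteredTriangularLeg`, as a function of `(R, σ, δ)`. -/
def jitLegProb (R : ConformalRectangle) (σ δ : ℝ) : ℝ :=
  ((Measure.infinitePi (fun _ : Site 2 ↦ (gaussianReal 0 1).prod (gaussianReal 0 1))).prod
      (sitePercolation (Site 2) half)).real
    {p | ∃ x ∈ R.arc 0, ∃ y ∈ R.arc 2, JoinedIn (closure R.carrier ∩
      {z | Metric.infDist (z / (δ : ℂ))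
          ((fun v ↦ triEmbed v + (σ : ℂ) * ((p.1 v).1 + (p.1 v).2 * Complex.I)) '' p.2) ≤
        Metric.infDist (z / (δ : ℂ))
          ((fun v ↦ triEmbed v + (σ : ℂ) * ((p.1 v).1 + (p.1 v).2 * Complex.I)) '' (p.2)ᶜ)}) x y}

/-- The route item `JitteredTriangularLeg` is, definitionally, "Smirnov ⟹ Cardy for `jitLegProb R σ`
for every `σ ≥ 0`". -/
theorem jitteredTriangularLeg_iff :
    Summit.CriticalPhenomena.CardyFormulaZ2.Theses.CardyFlipRusso.JitteredTriangularLeg ↔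
      (hasCrossingLimit_triDomainCrossingProb → ∀ σ : ℝ, 0 ≤ σ →
        ∀ R : ConformalRectangle, R.HasCrossingLimit (fun δ ↦ jitLegProb R σ δ) cardyFunction) :=
  Iff.rfl

/-- **DRAFT typing of the kernel crux, leg form (clause (iii) as consumed).** Along the jittered
triangular leg the annealed crossing probabilities are asymptotically constant in the leg
parameter, uniformly on compact `σ`-ranges: for every conformal rectangle `R`, every `σ₀ > 0` and
`ε > 0` there is `δ₀ > 0` such that `|P^δ_σ(R) − P^δ_{σ'}(R)| ≤ ε` for all `δ ∈ (0, δ₀)` and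
`σ, σ' ∈ [0, σ₀]`.  (Mechanism, for the docstring of the typed item: annealed flip–Russo formula in
`σ`, four-arm localisation of the flip response, and the quadrupole selection rule — the
`C₆`-invariance of the jitter law kills the marginal spin-2 channel; the order-2 control prediction
is a separate refutable item.) -/
def QuadrupoleSelectionRuleLegDraft : Prop :=
  ∀ (R : ConformalRectangle) (σ₀ : ℝ), 0 < σ₀ → ∀ ε : ℝ, 0 < ε → ∃ δ₀ : ℝ, 0 < δ₀ ∧
    ∀ δ : ℝ, 0 < δ → δ < δ₀ → ∀ σ ∈ Set.Icc (0 : ℝ) σ₀, ∀ σ' ∈ Set.Icc (0 : ℝ) σ₀,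
      |jitLegProb R σ δ - jitLegProb R σ' δ| ≤ ε

/-- Transfer of a one-sided limit at `0` along a uniformly close family. -/
theorem tendsto_of_forall_abs_sub_le {f g : ℝ → ℝ} {L : ℝ} (hf : Tendsto f (𝓝[>] 0) (𝓝 L))
    (hfg : ∀ ε : ℝ, 0 < ε → ∃ δ₀ : ℝ, 0 < δ₀ ∧ ∀ δ : ℝ, 0 < δ → δ < δ₀ → |g δ - f δ| ≤ ε) :
    Tendsto g (𝓝[>] 0) (𝓝 L) := by
  rw [Metric.tendsto_nhdsWithin_nhds] at hf ⊢
  intro ε hε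
  obtain ⟨δ₀, hδ₀, hclose⟩ := hfg (ε / 2) (half_pos hε)
  obtain ⟨η₀, hη₀, hlim⟩ := hf (ε / 2) (half_pos hε)
  refine ⟨min δ₀ η₀, lt_min hδ₀ hη₀, fun δ hδ hdist => ?_⟩
  have hδpos : 0 < δ := hδ
  have hδabs : |δ| < min δ₀ η₀ := by simpa [Real.dist_eq] using hdist
  rw [abs_of_pos hδpos] at hδabs
  have h1 := hclose δ hδpos (lt_of_lt_of_le hδabs (min_le_left _ _))
  have h2 := hlim hδ (by
    simpa [Real.dist_eq, abs_of_pos hδpos] using lt_of_lt_of_le hδabs (min_le_right _ _))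
  rw [Real.dist_eq] at h2 ⊢
  calc |g δ - L| = |(g δ - f δ) + (f δ - L)| := by ring_nf
    _ ≤ |g δ - f δ| + |f δ - L| := abs_add_le _ _
    _ < ε / 2 + ε / 2 := add_lt_add_of_le_of_lt h1 h2
    _ = ε := by ring

/-- **The draft is consumed exactly where the kernel is consumed.** If the leg-form draft holds and
Cardy's formula holds at the anchor `σ = 0` in the continuum (Voronoi/hexagon) discretisation,
then Cardy's formula holds for every `σ ≥ 0`, i.e. the conclusion of `JitteredTriangularLeg`. -/
theorem hasCrossingLimit_jitLeg_of_legDraft (h : QuadrupoleSelectionRuleLegDraft)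
    (h0 : ∀ R : ConformalRectangle, R.HasCrossingLimit (fun δ ↦ jitLegProb R 0 δ) cardyFunction)
    (σ : ℝ) (hσ : 0 ≤ σ) (R : ConformalRectangle) :
    R.HasCrossingLimit (fun δ ↦ jitLegProb R σ δ) cardyFunction := by
  intro φ x hunif
  refine tendsto_of_forall_abs_sub_le (h0 R φ x hunif) fun ε hε => ?_
  obtain ⟨δ₀, hδ₀, hclose⟩ := h R (σ + 1) (by linarith) ε hε
  refine ⟨δ₀, hδ₀, fun δ hδ hδ' => ?_⟩
  exact hclose δ hδ hδ' σ ⟨hσ, by linarith⟩ 0 ⟨le_rfl, by linarith⟩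

/-- Hence: draft + (Smirnov ⟹ the `σ = 0` anchor in the continuum discretisation) ⟹ the route
item `JitteredTriangularLeg`. -/
theorem jitteredTriangularLeg_of_legDraft (h : QuadrupoleSelectionRuleLegDraft)
    (h0 : hasCrossingLimit_triDomainCrossingProb →
      ∀ R : ConformalRectangle, R.HasCrossingLimit (fun δ ↦ jitLegProb R 0 δ) cardyFunction) :
    Summit.CriticalPhenomena.CardyFormulaZ2.Theses.CardyFlipRusso.JitteredTriangularLeg :=
  fun hS σ hσ R => hasCrossingLimit_jitLeg_of_legDraft h (h0 hS) σ hσ R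

end Summit.CriticalPhenomena.CardyFormulaZ2.Cruxes.QuadrupoleSelectionRule.TypingDraft

end
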